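import Mathlib
import Summits.Ventures.PercRepro2.ZMeanProof
import Summits.Ventures.PercRepro2.PendantRoot
import Summits.Ventures.PercRepro2.RootLeafUSepIndep

/-!
# The mean field is exact at a structurally isolated `a₃`: `HMFc = 0` (blind cell PercRepro2,
night-1 g16; NIGHT1-G16.md §6″)

If no edge of the graph touches `a₃` (`∀ e, a₃ ∉ ends e`) then `HMFc p ends o a₁ a₂ a₃ b = 0`
(**`HMFc_isolated`**), hence (HMF) (**`HMF_isolated`**).  The closed-leaf computation of
`HMFLeafStep.HMFc_update_zero` (night-1 g6) redone without a leaf edge: `PD = Q`, `T = T′ = ∅`, the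
cluster of `a₃` is `{a₃}` so `X̂ = termPD({a₃})` with the residual graph `G ∖ {a₃} = G` on the events
(`touches ends {a₃} = ∅`), and `P(Q)·X̂ = P(Q,oL)P(Q,bH) + P(Q,oH)P(Q,bL)`; the cleared form then
vanishes identically (`gap_eq_Q`).  Closes the isolated corner of the (HMF) class table modulo
reduction (SkeletonOneBranch.lean).

Own code; standard axioms.
-/

namespace Summit.Ventures.PercRepro2

open UnionCluster CovForm PendantRoot

namespace HMFIsolated

variable {V : Type*} {E : Type*} [Fintype E] [DecidableEq E] [Fintype V] [DecidableEq V]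
  {R : Type*} [Field R] [LinearOrder R] [IsStrictOrderedRing R]

variable (ends : E → Sym2 V) {a₃ : V}

omit [Fintype E] [DecidableEq E] [Fintype V] [DecidableEq V] in
/-- Nothing but `a₃` is connected to an isolated `a₃`. -/
lemma eq_of_conn (hiso : ∀ e, a₃ ∉ ends e) {ω : Config E} {x : V} (h : Conn ends ω x a₃) :
    x = a₃ :=
  RootLeafU.Sep.eq_of_conn_of_isolated (ends := ends) (fun e he => absurd he (hiso e)) h

omit [Fintype E] [DecidableEq E] [Fintype V] [DecidableEq V] in
/-- No vertex `x ≠ a₃` is ever connected to an isolated `a₃`. -/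
lemma connEvent_eq_empty (hiso : ∀ e, a₃ ∉ ends e) {x : V} (hx : x ≠ a₃) :
    connEvent ends x a₃ = ∅ := by
  ext ω
  simp only [mem_connEvent, Set.mem_empty_iff_false, iff_false]
  exact fun h => hx (eq_of_conn ends hiso h)

omit [Fintype E] [DecidableEq E] [Fintype V] [DecidableEq V] in
/-- The same with the roles exchanged. -/
lemma connEvent_eq_empty' (hiso : ∀ e, a₃ ∉ ends e) {x : V} (hx : x ≠ a₃) :
    connEvent ends a₃ x = ∅ := by
  ext ω
  simp only [mem_connEvent, Set.mem_empty_iff_false, iff_false]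
  exact fun h => hx (eq_of_conn ends hiso (conn_symm h))

omit [Fintype E] [DecidableEq E] [Fintype V] [DecidableEq V] in
/-- `PD = Q` at an isolated `a₃`. -/
lemma PDEvent_eq (hiso : ∀ e, a₃ ∉ ends e) {a₁ a₂ : V} (h1 : a₁ ≠ a₃) (h2 : a₂ ≠ a₃) :
    PDEvent ends a₁ a₂ a₃ = avoidAll ends a₂ {a₁} := by
  rw [avoidAll_eq_compl]
  ext ω
  rw [mem_PDEvent_iff, Set.mem_compl_iff, mem_connEvent]
  constructor
  · exact fun h => h.1
  · intro h
    exact ⟨h, fun hc => h1 (eq_of_conn ends hiso (conn_symm hc)),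
      fun hc => h2 (eq_of_conn ends hiso (conn_symm hc))⟩

omit [Fintype E] [DecidableEq E] [Fintype V] [DecidableEq V] in
/-- `T = ∅` at an isolated `a₃`. -/
lemma TEvent_eq (hiso : ∀ e, a₃ ∉ ends e) {a₁ a₂ : V} (h2 : a₂ ≠ a₃) :
    TEvent ends a₁ a₂ a₃ = ∅ := by
  unfold TEvent
  rw [connEvent_eq_empty ends hiso h2, Set.inter_empty]

omit [Fintype E] [DecidableEq E] [Fintype V] [DecidableEq V] in
/-- The cluster of an isolated `a₃` is `{a₃}`. -/
lemma cluster_eq (hiso : ∀ e, a₃ ∉ ends e) (ω : Config E) : cluster ends ω a₃ = {a₃} := by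
  ext u
  simp only [mem_cluster, Set.mem_singleton_iff]
  constructor
  · exact fun h => eq_of_conn ends hiso (conn_symm h)
  · rintro rfl; exact conn_refl ends ω u

omit [Fintype E] [DecidableEq E] [Fintype V] in
/-- The cluster event of an isolated `a₃`. -/
lemma clusterEvent_eq (hiso : ∀ e, a₃ ∉ ends e) (W : Finset V) :
    clusterEvent ends a₃ (↑W : Set V) = if W = {a₃} then Set.univ else ∅ := by
  ext ω
  rw [mem_clusterEvent, cluster_eq ends hiso]
  by_cases hW : W = {a₃}
  · subst hW; simp
  · rw [if_neg hW]
    simp only [Set.mem_empty_iff_false, iff_false]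
    intro h
    apply hW
    have : (↑W : Set V) = ↑({a₃} : Finset V) := by rw [← h]; simp
    exact Finset.coe_injective this

omit [Fintype E] [DecidableEq E] [Fintype V] [DecidableEq V] in
/-- No edge touches `{a₃}`. -/
lemma touches_eq (hiso : ∀ e, a₃ ∉ ends e) : touches ends (↑({a₃} : Finset V) : Set V) = ∅ := by
  ext e
  simp only [mem_touches, Finset.coe_singleton, Set.mem_singleton_iff, exists_eq_left,
    Set.mem_empty_iff_false, iff_false, not_exists]
  intro y hy
  exact hiso e (by rw [hy]; exact Sym2.mem_mk_left a₃ y)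

omit [Fintype E] [DecidableEq E] in
/-- Restricting to the complement of `touches ends {a₃}` changes nothing at an isolated `a₃`. -/
lemma restrict_touches (hiso : ∀ e, a₃ ∉ ends e) (ω : Config E) :
    restrict (touches ends (↑({a₃} : Finset V) : Set V))ᶜ ω = ω := by
  funext e
  have hnot : e ∉ touches ends (↑({a₃} : Finset V) : Set V) := by
    rintro ⟨x, hx, y, hy⟩
    rw [Finset.coe_singleton, Set.mem_singleton_iff] at hx
    subst hx
    exact hiso e (by rw [hy]; exact Sym2.mem_mk_left x y)
  simp only [restrict]
  rw [decide_eq_true (Set.mem_compl hnot), Bool.and_true]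

omit [Fintype E] [DecidableEq E] in
/-- Removing an isolated `a₃` does not change connections. -/
lemma connDelEvent_eq (hiso : ∀ e, a₃ ∉ ends e) (x y : V) :
    connDelEvent ends {a₃} x y = connEvent ends x y := by
  ext ω
  rw [mem_connEvent]
  unfold connDelEvent
  rw [Set.mem_setOf_eq, restrict_touches ends hiso]

omit [Fintype E] [DecidableEq E] in
/-- The residual `Q` of an isolated `a₃` is `Q`. -/
lemma delQ_eq (hiso : ∀ e, a₃ ∉ ends e) (a₁ a₂ : V) :
    delQ ends {a₃} a₁ a₂ = avoidAll ends a₂ {a₁} := by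
  unfold delQ
  rw [connDelEvent_eq ends hiso, avoidAll_eq_compl]

variable (p : E → R)

omit [LinearOrder R] [IsStrictOrderedRing R] in
/-- `X̂ = termPD({a₃})` at an isolated `a₃`, written out. -/
lemma Xhat_eq (hiso : ∀ e, a₃ ∉ ends e) {o a₁ a₂ b : V} (h1 : a₁ ≠ a₃) (h2 : a₂ ≠ a₃)
    (ho : o ≠ a₃) (hb : b ≠ a₃) :
    Xhat p ends o a₁ a₂ a₃ b =
      (prob p (avoidAll ends a₂ {a₁} ∩ connEvent ends a₁ o) *
          prob p (avoidAll ends a₂ {a₁} ∩ connEvent ends a₂ b) +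
        prob p (avoidAll ends a₂ {a₁} ∩ connEvent ends a₂ o) *
          prob p (avoidAll ends a₂ {a₁} ∩ connEvent ends a₁ b)) /
        prob p (avoidAll ends a₂ {a₁}) := by
  rw [Xhat_eq_sum]
  rw [Finset.sum_eq_single ({a₃} : Finset V)]
  · rw [clusterEvent_eq ends hiso, if_pos rfl, prob_univ, one_mul]
    have h1' : a₁ ∉ ({a₃} : Finset V) := by simp [h1]
    have h2' : a₂ ∉ ({a₃} : Finset V) := by simp [h2]
    have ho' : o ∉ ({a₃} : Finset V) := by simp [ho]
    have hb' : b ∉ ({a₃} : Finset V) := by simp [hb]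
    simp only [termW, h1', h2', if_false, termPD, delShareMass, ho', hb', delQ_eq ends hiso,
      connDelEvent_eq ends hiso]
  · intro W _ hW
    rw [clusterEvent_eq ends hiso, if_neg hW, prob_empty, zero_mul]
  · intro h; exact absurd (Finset.mem_univ _) h

/-- **The mean field is exact at an isolated `a₃`: `HMFc = 0`.** -/
theorem HMFc_isolated (hiso : ∀ e, a₃ ∉ ends e) {o a₁ a₂ b : V} (h1 : a₁ ≠ a₃)
    (h2 : a₂ ≠ a₃) (ho : o ≠ a₃) (hb : b ≠ a₃) : HMFc p ends o a₁ a₂ a₃ b = 0 := by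
  have hX := Xhat_eq ends p hiso h1 h2 ho hb
  unfold HMFc marginC DEF Do EQo EQ3 EQ3o massM2 deltaT
  rw [gap_eq_Q, PDEvent_eq ends hiso h1 h2, TEvent_eq ends hiso h2, TEvent_eq ends hiso h1, hX]
  simp only [Set.empty_inter, Set.inter_empty, prob_empty, sub_zero, mul_zero, sub_self, add_zero]
  by_cases hZ : prob p (avoidAll ends a₂ {a₁}) = 0
  · rw [hZ]; ring
  · field_simp
    ring

/-- **(HMF) at an isolated `a₃`.** -/
theorem HMF_isolated (hiso : ∀ e, a₃ ∉ ends e) {o a₁ a₂ b : V} (h1 : a₁ ≠ a₃)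
    (h2 : a₂ ≠ a₃) (ho : o ≠ a₃) (hb : b ≠ a₃) : HMF p ends o a₁ a₂ a₃ b := by
  unfold HMF
  rw [HMFc_isolated ends p hiso h1 h2 ho hb]

end HMFIsolated

end Summit.Ventures.PercRepro2
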